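import Summits.HodgeConjecture.HodgeConjecture.Theses.GaloisSieve
import Literature.AlgebraicGeometry.HodgeTheory.AokiShiodaSurfaceEigenlinesHolds
import HarnessLib

/-!
# Route `GaloisSieve`, support `FermatSurfaceEigenlines` (stmt-HodgeConjecture-14563)

Every Hodge eigenline `V(α)`, `α ∈ 𝔅²ₘ`, of the Fermat surface `X²ₘ` consists of algebraic classes —
the tree's DISCHARGED named fact `AokiShioda1983_eigenline_le_neronSeveri`
(`AokiShioda1983_eigenline_le_neronSeveri_holds`: Lefschetz `(1,1)` + vanishing of the `(2,0)`-parts of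
the Hodge eigenlines, Shioda (1.7)), after the dictionary "explicit eigen-identity for all diagonal
`a` with `aᵢᵐ = 1` ⟹ `c ∈ V(α)`" (`mem_fermatEigenspace_iff`, `fermatCharacter_apply`).
-/

set_option linter.dupNamespace false

noncomputable section

namespace Summit.HodgeConjecture.HodgeConjecture.Theorems

open Literature.AlgebraicGeometry.Motives Literature.AlgebraicGeometry.HodgeTheory
  Literature.AlgebraicTopology.SingularHomology

/-- Dictionary, converse direction: a class satisfying the explicit eigen-identity
`g_a^* c = (∏ᵢ aᵢ^{⟨αᵢ⟩}) • c` for every diagonal `a` with `aᵢᵐ = 1` lies in the eigenspace `V(α)`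
(`mem_fermatEigenspace_iff`, `fermatCharacter_apply`; the two `diagonalMap`s agree by proof
irrelevance of the stabilizer witness). [cite: Shioda1979PJA, §4] -/
theorem galoisSieve_mem_fermatEigenspace_of_diagonalMap_eq {n m : ℕ} {α : Fin (n + 2) → ZMod m}
    {k : ℕ} {c : complexBetti (SmoothHypersurface.hypersurface (fermatPolynomial ℂ n m)) k}
    (hc : ∀ (a : Fin (n + 2) → ℂˣ) (ha : a ∈ diagonalStabilizer (fermatPolynomial ℂ n m)),
      (∀ i, a i ^ m = 1) → singularCohomology.map ℂ ℂ (diagonalMap (fermatPolynomial ℂ n m) ha) k c =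
        (∏ i, (a i : ℂ) ^ (α i).val) • c) :
    c ∈ fermatEigenspace m α k := by
  refine mem_fermatEigenspace_iff.2 fun a ↦ ?_
  rw [hc (a : Fin (n + 2) → ℂˣ) (fermatGroup_le_diagonalStabilizer m a.2) (mem_fermatGroup_iff.1 a.2),
    fermatCharacter_apply, Units.coe_prod]
  simp only [Units.val_pow_eq_pow_val]

/-- **Support item `FermatSurfaceEigenlines` of route `GaloisSieve`** (stmt-HodgeConjecture-14563):
the Hodge eigenlines of the Fermat surfaces are algebraic — the tree's discharged fact
`AokiShioda1983_eigenline_le_neronSeveri_holds` through the dictionary above.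
[cite: AokiShioda1983, §2 (2.1)–(2.2), p. 3] [cite: Shioda1979HodgeFermat, §1 (1.7) and Thm. I] -/
theorem galoisSieve_fermatSurfaceEigenlines_proof :
    Summit.HodgeConjecture.HodgeConjecture.Theses.GaloisSieve.FermatSurfaceEigenlines := by
  intro m _ α hα c hc
  exact AokiShioda1983_eigenline_le_neronSeveri_holds m α hα
    (galoisSieve_mem_fermatEigenspace_of_diagonalMap_eq hc)

end Summit.HodgeConjecture.HodgeConjecture.Theorems

end
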